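import Summits.BirchSwinnertonDyer.BirchSwinnertonDyer.Theorems.EisensteinPrimesBSDpOnCellCTelescopeCarrierAlgOfWitness
import Summits.BirchSwinnertonDyer.BirchSwinnertonDyer.Theorems.EisensteinPrimesBSDpOnCellCRetractionSpecializationCyclic
import Summits.BirchSwinnertonDyer.Rank1Residual.X11b.BDPRouteOpenInputDegenerateFrame
import Literature.NumberTheory.EllipticCurves.IwasawaAlgebraRankOneIdealProofs
import Summits.BirchSwinnertonDyer.BirchSwinnertonDyer.Theorems.EisensteinPrimesBSDpOnCellCTelescopeCarrierAlgWOfDivInt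
import HarnessLib

/-!
# [telescope v16 — successor LEAD cruxlead-19034 g4, 2026-08-30] PREFIX⁺ RE-PORT: the road-prefix package of the leaves gains two trailing conjuncts,
# (wt) `∃ M, ∀ k, (p : ℤ_[p])^M * x k = ((D k).k − 2 : ℤ)` (the chart variable IS the rescaled weight — `IsPNewBranchAnalyticChart` clause (wt)) and
# (rat) `∀ k, Function.Surjective (algebraMap ℤ_[p] (padicCoeffIntegers (D k).ι))` (the members on the étale branch through the RATIONAL newform f_E are
# ℚ_p-rational — print: Hida 1986 Cor. 1.4, Greenberg–Stevens 1993 §2, Venerucci 2016 §2.4; typer flag T1-R0), so that the construction leaf N1 no longer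
# CLAIMS (rat_k) about its input (width x2-p2 g23 `N1-TYPING-x2p2g23.md`, ideator g40 `N1-PRICING.md` §0; LEAD ruling STATUS 08:45:48Z). Statement = the
# F-form original with the two conjuncts appended at EVERY occurrence of the package; proof token-identical.
# THIS FILE = `TelescopeCarrierAlgWOfDivIntF` (member clauses in F-form) on prefix⁺, hypothesis and conclusion. (`--supports`, helper; closes nothing; THEOREMS ONLY; BSD proved for no curve.)
-/

set_option autoImplicit false
-- D-0017: single-problem summit, the namespace repeats the problem name by design.
set_option linter.dupNamespace false

noncomputable section

open scoped Classical MatrixGroups ModularForm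

open CongruenceSubgroup WeierstrassCurve NumberField IsDedekindDomain Field PowerSeries
  Literature.NumberTheory.EllipticCurves Literature.NumberTheory.EllipticCurves.GreenbergSelmer
  Literature.NumberTheory.EllipticCurves.ModularForms Literature.NumberTheory.QuadraticFields
  Literature.NumberTheory.EllipticCurves.Rank1Residual
  Literature.NumberTheory.EllipticCurves.Rank1Residual.Typed
  Literature.NumberTheory.GaloisRepresentations Literature.NumberTheory.GaloisCohomology
  Summit.BirchSwinnertonDyer.Rank1Residual.X11b.AcSelmer
  Summit.BirchSwinnertonDyer.Rank1Residual.X11b.Halves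
  Summit.BirchSwinnertonDyer.Rank1Residual.X11b
  Summit.BirchSwinnertonDyer.Rank1Residual Summit.BirchSwinnertonDyer.Rank1Residual.X1
  Summit.BirchSwinnertonDyer.Rank1Residual.X2

open Literature.NumberTheory.EllipticCurves.BigGaloisRep
open Literature.NumberTheory.EllipticCurves.Castella2018

namespace Summit.BirchSwinnertonDyer.BirchSwinnertonDyer.Theorems.TelescopeCarrierAlgWOfDivIntFP

open Summit.BirchSwinnertonDyer.BirchSwinnertonDyer.Theorems

set_option maxHeartbeats 1600000 in
/-- **K2-W from K2-D♭.** `F :=` the image of `F₀` in `R₀⟦X⟧⟦T⟧`; `𝒩 := R₀⟦X⟧⟦T⟧ ⧸ (F)` (cyclic): `char 𝒩 = (F)`; (nondeg)/(alg∞) are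
`F₀`'s read through `toUnr`/`unrToCpInt ∘ toUnr = toCpInt`; per member the regularity element is `F` (`F(x_k,T) = Φ₀ ≠ 0`), and
`𝒩/(X − x_k)𝒩 ≃ R₀⟦T⟧/(F(x_k,T))` (x2-p2 g18, p729512) gives `char_{R₀⟦T⟧}(𝒩/(X − x_k)𝒩)·𝓞_{ℂ_p}⟦T⟧ = (Φ₀)·𝓞_{ℂ_p}⟦T⟧ ⊇ p^j·Ch(X(g_k))`.
Sorry-free; ideator bsd-idea-12 g31's text (crux workfile `Lines/telescopeK2int.lean` a94fce70a943 §K) ported verbatim with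
the §C copies replaced by the landed tree names (x2-p2 g18 p729512 `RetractionSpecialization.*`, LEAD p729576
`TelescopeCarrierAlgOfWitness.*`). [folklore] -/
theorem carrierAlgW_of_divInt
    (hD :     ∀ (W : WeierstrassCurve ℚ) [W.IsElliptic] [W.IsGloballyMinimal] (p : ℕ) [Fact p.Prime],
    ∀ (N : ℕ) [NeZero N] (K : Type) [Field K] [NumberField K] (Dt : ModularParametrizationData W N)
      (H : HeegnerDatum N (NumberField.discr K)) (ιK : K →+* ℂ) (P : (W.baseChange K).toAffine.Point),
      CellC W p → W.conductorNorm ℤ = N →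
      IsImaginaryQuadratic K → NumberField.discr K < -4 → SatisfiesHeegnerHypothesis N K →
      (W.quadraticTwist (NumberField.discr K : ℚ)).entireLFunction 1 ≠ 0 →
      WeierstrassCurve.Affine.Point.map ιK.toRatAlgHom P = heegnerPointComplex Dt H →
      ¬ (p : ℤ) ∣ Dt.c → ¬ IsOfFinAddOrder P →
      Odd (NumberField.discr K) →
      ∀ (κ : ZpExtension K p), κ.IsAnticyclotomic →
        ∀ (γ : Field.absoluteGaloisGroup K) [Fact (κ.IsTopGenerator γ)]
          (𝔭 : HeightOneSpectrum (𝓞 K)), ((p : ℕ) : 𝓞 K) ∈ 𝔭.asIdeal →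
          𝔭.asIdeal.ramificationIdx (𝓞 ℚ) = 1 → 𝔭.asIdeal.inertiaDeg (𝓞 ℚ) = 1 →
          ∀ (𝔭bar : HeightOneSpectrum (𝓞 K)), ((p : ℕ) : 𝓞 K) ∈ 𝔭bar.asIdeal → 𝔭bar ≠ 𝔭 →
            ((Ideal.span {(p : ℤ)}).primesOver (𝓞 K)).ncard = 2 →
          ∀ (f : CuspForm (CongruenceSubgroup.Gamma0 N) 2), IsNewformOf W f →
            ∀ (ι' : PadicAlgCl p ≃+* ℂ),
              (∀ (w : InfinitePlace K) (k : 𝓞 K),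
                k ∈ 𝔭.asIdeal ↔ ‖ι'.symm (w.embedding (k : K))‖ < 1) →
              ∀ (ΩK : ℂ) (Ωp : ℂ_[p]) (Q : PowerSeries 𝓞_ℂ_[p]), ΩK ≠ 0 → ‖Ωp‖ = 1 →
                R1.IsBDPLFunctionInt p ι' 𝔭 κ γ f ΩK Ωp Q →
      ∀ (L : PowerSeries (PowerSeries (unrIntegers p))) (x : ℕ → ℤ_[p]) (D : ℕ → Skinner2016.HidaCongruentForm W p 1),
        (∀ k, ‖x k‖ < 1) ∧ Filter.Tendsto x Filter.atTop (nhds 0) ∧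
        (∃ e : ℕ, PowerSeries.C ((p : 𝓞_ℂ_[p]) ^ e) * Q ∈
          Ideal.span {PowerSeries.map (R1.unrToCpInt p) (PowerSeries.map (PowerSeries.constantCoeff (R := unrIntegers p)) L)}) ∧
        (∀ k : ℕ, (∀ y : coeffField (D k).g, ι' ((D k).ι y) = (y : ℂ)) ∧ 2 * ((p : ℤ) - 1) ∣ (D k).k - 2 ∧
          ∃ (ΩKg : ℂ) (Ωpg : ℂ_[p]) (Lg : UnrSeries p), ΩKg ≠ 0 ∧ ‖Ωpg‖ = 1 ∧
            IsBDPLFunctionWt ι' 𝔭 κ γ (D k).g ΩKg Ωpg Lg ∧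
          ∃ Ψ : UnrSeries p,
            (∃ U : PowerSeries (PowerSeries (unrIntegers p)),
              PowerSeries.map (PowerSeries.C (R := unrIntegers p)) Ψ =
                L + PowerSeries.C (PowerSeries.X - PowerSeries.C (toUnr p (x k))) * U) ∧
            (∃ e : ℕ, PowerSeries.C ((p : 𝓞_ℂ_[p]) ^ e) * PowerSeries.map (R1.unrToCpInt p) Ψ ∈
              Ideal.span {PowerSeries.map (R1.unrToCpInt p) Lg})) ∧
        (∃ A : ℕ → UnrSeries p, ∀ ℓ : ℕ, ℓ.Prime → ¬ ℓ ∣ N →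
          (∃ U : UnrSeries p, A ℓ = PowerSeries.C (toUnr p ((W.frobeniusTrace ℓ : ℤ) : ℤ_[p])) + PowerSeries.X * U) ∧
          ∀ k : ℕ, ∃ (c : unrIntegers p) (U : UnrSeries p),
            A ℓ = PowerSeries.C c + (PowerSeries.X - PowerSeries.C (toUnr p (x k))) * U ∧
            ((c : ℂ_[p]) = algebraMap (PadicAlgCl p) ℂ_[p]
              ((D k).ι ⟨(UpperHalfPlane.qExpansion 1 ⇑(D k).g).coeff ℓ, coeff_mem_coeffField (D k).g ℓ⟩))) ∧
        (∃ M : ℕ, ∀ k : ℕ, ((p : ℤ_[p]) ^ M) * x k = (((D k).k - 2 : ℤ) : ℤ_[p])) ∧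
        (∀ k : ℕ, Function.Surjective (algebraMap ℤ_[p] (padicCoeffIntegers (D k).ι))) →
      ∃ F₀ : PowerSeries (PowerSeries ℤ_[p]),
        ¬ (PowerSeries.C (PowerSeries.X : PowerSeries ℤ_[p]) ∣ F₀) ∧
        (∃ j : ℕ, PowerSeries.C ((p : 𝓞_ℂ_[p]) ^ j) *
            PowerSeries.map (R1.toCpInt p) (PowerSeries.map (PowerSeries.constantCoeff (R := ℤ_[p])) F₀) ∈
          (XAc.charIdeal (W.baseChange K) p κ 𝔭bar ∅ γ).map (PowerSeries.map (R1.toCpInt p))) ∧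
        ∃ bad : Set ℤ_[p], bad.Finite ∧ ∀ k : ℕ, x k ∉ bad → ∃ Φ₀ : PowerSeries ℤ_[p], Φ₀ ≠ 0 ∧
          (∃ U : PowerSeries (PowerSeries ℤ_[p]),
            PowerSeries.map (PowerSeries.C (R := ℤ_[p])) Φ₀ =
              F₀ + PowerSeries.C (PowerSeries.X - PowerSeries.C (x k)) * U) ∧
          ∀ (b : padicCoeffIntegers (D k).ι →+* 𝓞_ℂ_[p]),
            (∀ y, ((b y : 𝓞_ℂ_[p]) : ℂ_[p]) =
              algebraMap (PadicAlgCl p) ℂ_[p] (padicCoeffIntegers.toPadicAlgCl (D k).ι y)) →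
          ∀ [TopologicalSpace (PowerSeries (padicCoeffIntegers (D k).ι))]
            [ContinuousSMul (PowerSeries (padicCoeffIntegers (D k).ι))
              (BigRepModule (padicCoeffIntegers (D k).ι) p (Cofree (D k).Δ.selfDualRep (padicCoeffField (D k).ι)))],
            ∃ j : ℕ, Ideal.span {PowerSeries.C ((p : 𝓞_ℂ_[p]) ^ j)} *
                (XBig.charIdeal κ ((D k).Δ.selfDualCofreeRepOver K) 𝔭bar
                  (∅ : Set (HeightOneSpectrum (𝓞 K)))).map (PowerSeries.map b) ≤
              Ideal.span {PowerSeries.map (R1.toCpInt p) Φ₀}) :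
    ∀ (W : WeierstrassCurve ℚ) [W.IsElliptic] [W.IsGloballyMinimal] (p : ℕ) [Fact p.Prime],
    ∀ (N : ℕ) [NeZero N] (K : Type) [Field K] [NumberField K] (Dt : ModularParametrizationData W N)
      (H : HeegnerDatum N (NumberField.discr K)) (ιK : K →+* ℂ) (P : (W.baseChange K).toAffine.Point),
      CellC W p → W.conductorNorm ℤ = N →
      IsImaginaryQuadratic K → NumberField.discr K < -4 → SatisfiesHeegnerHypothesis N K →
      (W.quadraticTwist (NumberField.discr K : ℚ)).entireLFunction 1 ≠ 0 →
      WeierstrassCurve.Affine.Point.map ιK.toRatAlgHom P = heegnerPointComplex Dt H →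
      ¬ (p : ℤ) ∣ Dt.c → ¬ IsOfFinAddOrder P →
      Odd (NumberField.discr K) →
      ∀ (κ : ZpExtension K p), κ.IsAnticyclotomic →
        ∀ (γ : Field.absoluteGaloisGroup K) [Fact (κ.IsTopGenerator γ)]
          (𝔭 : HeightOneSpectrum (𝓞 K)), ((p : ℕ) : 𝓞 K) ∈ 𝔭.asIdeal →
          𝔭.asIdeal.ramificationIdx (𝓞 ℚ) = 1 → 𝔭.asIdeal.inertiaDeg (𝓞 ℚ) = 1 →
          ∀ (𝔭bar : HeightOneSpectrum (𝓞 K)), ((p : ℕ) : 𝓞 K) ∈ 𝔭bar.asIdeal → 𝔭bar ≠ 𝔭 →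
            ((Ideal.span {(p : ℤ)}).primesOver (𝓞 K)).ncard = 2 →
          ∀ (f : CuspForm (CongruenceSubgroup.Gamma0 N) 2), IsNewformOf W f →
            ∀ (ι' : PadicAlgCl p ≃+* ℂ),
              (∀ (w : InfinitePlace K) (k : 𝓞 K),
                k ∈ 𝔭.asIdeal ↔ ‖ι'.symm (w.embedding (k : K))‖ < 1) →
              ∀ (ΩK : ℂ) (Ωp : ℂ_[p]) (Q : PowerSeries 𝓞_ℂ_[p]), ΩK ≠ 0 → ‖Ωp‖ = 1 →
                R1.IsBDPLFunctionInt p ι' 𝔭 κ γ f ΩK Ωp Q →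
      ∀ (L : PowerSeries (PowerSeries (unrIntegers p))) (x : ℕ → ℤ_[p]) (D : ℕ → Skinner2016.HidaCongruentForm W p 1),
        (∀ k, ‖x k‖ < 1) ∧ Filter.Tendsto x Filter.atTop (nhds 0) ∧
        (∃ e : ℕ, PowerSeries.C ((p : 𝓞_ℂ_[p]) ^ e) * Q ∈
          Ideal.span {PowerSeries.map (R1.unrToCpInt p) (PowerSeries.map (PowerSeries.constantCoeff (R := unrIntegers p)) L)}) ∧
        (∀ k : ℕ, (∀ y : coeffField (D k).g, ι' ((D k).ι y) = (y : ℂ)) ∧ 2 * ((p : ℤ) - 1) ∣ (D k).k - 2 ∧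
          ∃ (ΩKg : ℂ) (Ωpg : ℂ_[p]) (Lg : UnrSeries p), ΩKg ≠ 0 ∧ ‖Ωpg‖ = 1 ∧
            IsBDPLFunctionWt ι' 𝔭 κ γ (D k).g ΩKg Ωpg Lg ∧
          ∃ Ψ : UnrSeries p,
            (∃ U : PowerSeries (PowerSeries (unrIntegers p)),
              PowerSeries.map (PowerSeries.C (R := unrIntegers p)) Ψ =
                L + PowerSeries.C (PowerSeries.X - PowerSeries.C (toUnr p (x k))) * U) ∧
            (∃ e : ℕ, PowerSeries.C ((p : 𝓞_ℂ_[p]) ^ e) * PowerSeries.map (R1.unrToCpInt p) Ψ ∈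
              Ideal.span {PowerSeries.map (R1.unrToCpInt p) Lg})) ∧
        (∃ A : ℕ → UnrSeries p, ∀ ℓ : ℕ, ℓ.Prime → ¬ ℓ ∣ N →
          (∃ U : UnrSeries p, A ℓ = PowerSeries.C (toUnr p ((W.frobeniusTrace ℓ : ℤ) : ℤ_[p])) + PowerSeries.X * U) ∧
          ∀ k : ℕ, ∃ (c : unrIntegers p) (U : UnrSeries p),
            A ℓ = PowerSeries.C c + (PowerSeries.X - PowerSeries.C (toUnr p (x k))) * U ∧
            ((c : ℂ_[p]) = algebraMap (PadicAlgCl p) ℂ_[p]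
              ((D k).ι ⟨(UpperHalfPlane.qExpansion 1 ⇑(D k).g).coeff ℓ, coeff_mem_coeffField (D k).g ℓ⟩))) ∧
        (∃ M : ℕ, ∀ k : ℕ, ((p : ℤ_[p]) ^ M) * x k = (((D k).k - 2 : ℤ) : ℤ_[p])) ∧
        (∀ k : ℕ, Function.Surjective (algebraMap ℤ_[p] (padicCoeffIntegers (D k).ι))) →
      ∃ (F : PowerSeries (PowerSeries (unrIntegers p)))
        (𝒩 : Type) (_ : AddCommGroup 𝒩) (_ : Module (PowerSeries (PowerSeries (unrIntegers p))) 𝒩)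
        (_ : Module (PowerSeries (unrIntegers p)) 𝒩)
        (_ : IsScalarTower (PowerSeries (unrIntegers p)) (PowerSeries (PowerSeries (unrIntegers p))) 𝒩)
        (_ : Module.Finite (PowerSeries (PowerSeries (unrIntegers p))) 𝒩),
        Literature.NumberTheory.EllipticCurves.Module.charIdeal (PowerSeries (PowerSeries (unrIntegers p))) 𝒩 =
          Ideal.span {F} ∧
        ¬ (PowerSeries.C (PowerSeries.X : PowerSeries (unrIntegers p)) ∣ F) ∧
        (∃ j : ℕ, PowerSeries.C ((p : 𝓞_ℂ_[p]) ^ j) *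
            PowerSeries.map (R1.unrToCpInt p) (PowerSeries.map (PowerSeries.constantCoeff (R := unrIntegers p)) F) ∈
          (XAc.charIdeal (W.baseChange K) p κ 𝔭bar ∅ γ).map (PowerSeries.map (R1.toCpInt p))) ∧
        ∃ bad : Set ℤ_[p], bad.Finite ∧ ∀ k : ℕ, x k ∉ bad →
          (∃ s : PowerSeries (PowerSeries (unrIntegers p)),
            ¬ (PowerSeries.C (PowerSeries.X - PowerSeries.C (toUnr p (x k))) ∣ s) ∧ ∀ m : 𝒩, s • m = 0) ∧
          ∀ (b : padicCoeffIntegers (D k).ι →+* 𝓞_ℂ_[p]),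
            (∀ y, ((b y : 𝓞_ℂ_[p]) : ℂ_[p]) =
              algebraMap (PadicAlgCl p) ℂ_[p] (padicCoeffIntegers.toPadicAlgCl (D k).ι y)) →
          ∀ [TopologicalSpace (PowerSeries (padicCoeffIntegers (D k).ι))]
            [ContinuousSMul (PowerSeries (padicCoeffIntegers (D k).ι))
              (BigRepModule (padicCoeffIntegers (D k).ι) p (Cofree (D k).Δ.selfDualRep (padicCoeffField (D k).ι)))],
            ∃ j : ℕ, Ideal.span {PowerSeries.C ((p : 𝓞_ℂ_[p]) ^ j)} *
                (XBig.charIdeal κ ((D k).Δ.selfDualCofreeRepOver K) 𝔭bar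
                  (∅ : Set (HeightOneSpectrum (𝓞 K)))).map (PowerSeries.map b) ≤
              (Literature.NumberTheory.EllipticCurves.Module.charIdeal (PowerSeries (unrIntegers p))
                  (QuotSMulTop (PowerSeries.C (PowerSeries.X - PowerSeries.C (toUnr p (x k)))) 𝒩)).map
                (PowerSeries.map (R1.unrToCpInt p)) := by
  intro W _ _ p _ N _ K _ _ Dt H ιK P hC hN hK hdisc hHeeg hL1 hP hc hfin hodd κ hκ γ _ 𝔭 h𝔭 hram hdeg 𝔭bar
    h𝔭bar hne hsp f hf ι' hι' ΩK Ωp Q hΩK hΩp hQ L x D hpkg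
  obtain ⟨F₀, hX₀, halg₀, Fx, hFx, hmem₀⟩ :=
    hD W p N K Dt H ιK P hC hN hK hdisc hHeeg hL1 hP hc hfin hodd κ hκ γ 𝔭 h𝔭 hram hdeg 𝔭bar h𝔭bar hne
      hsp f hf ι' hι' ΩK Ωp Q hΩK hΩp hQ L x D hpkg
  have hxk : ∀ k, ‖x k‖ < 1 := hpkg.1
  -- the receptacle `R₀ = unrIntegers p`: a complete DVR with uniformiser `p`; `R₀⟦T⟧`, `R₀⟦X⟧⟦T⟧` factorial
  haveI := HidaLimitAlgebra.isDiscreteValuationRing_unrIntegers (p := p)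
  haveI : IsAdicComplete (IsLocalRing.maximalIdeal (unrIntegers p)) (unrIntegers p) :=
    CongruentShaFreeCutUnrSeriesWeierstrass.isAdicComplete_maximalIdeal
  haveI : UniqueFactorizationMonoid (PowerSeries (PowerSeries (unrIntegers p))) :=
    Literature.NumberTheory.IwasawaTheory.uniqueFactorizationMonoid_powerSeries_powerSeries (unrIntegers p)
  haveI : UniqueFactorizationMonoid (PowerSeries (unrIntegers p)) :=
    TelescopeCarrierAlgOfWitness.uniqueFactorizationMonoid_unrSeries p
  have hirr : Irreducible ((p : ℕ) : unrIntegers p) := HidaLimitAlgebra.irreducible_natCast_p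
  have hpmem : ((p : ℕ) : unrIntegers p) ∈ IsLocalRing.maximalIdeal (unrIntegers p) :=
    (IsLocalRing.mem_maximalIdeal _).mpr hirr.not_isUnit
  have hpt : ∀ z : ℤ_[p], ‖z‖ < 1 → toUnr p z ∈ IsLocalRing.maximalIdeal (unrIntegers p) := by
    intro z hz
    obtain ⟨y, hy⟩ := (PadicInt.norm_lt_one_iff_dvd z).mp hz
    rw [hy, map_mul, map_natCast]
    exact Ideal.mul_mem_right _ _ hpmem
  -- the coefficient maps `Λ → Λ_{R₀}` and `ℤ_p⟦X⟧⟦T⟧ → R₀⟦X⟧⟦T⟧`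
  set Φ₁ : PowerSeries ℤ_[p] →+* PowerSeries (unrIntegers p) := PowerSeries.map (toUnr p) with hΦ₁
  set Φ₂ : PowerSeries (PowerSeries ℤ_[p]) →+* PowerSeries (PowerSeries (unrIntegers p)) :=
    PowerSeries.map Φ₁ with hΦ₂
  have hΦ₁inj : Function.Injective Φ₁ := map_toUnr_injective
  set F : PowerSeries (PowerSeries (unrIntegers p)) := Φ₂ F₀ with hFdef
  -- (nondeg) transported along the injective `toUnr`
  have hXF : ¬ (PowerSeries.C (PowerSeries.X : PowerSeries (unrIntegers p)) ∣ F) := by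
    intro hdvd
    apply hX₀
    refine TelescopeCarrierAlgWOfDivInt.C_dvd_of_forall_dvd_coeff _ _ fun n => ?_
    have h1 := TelescopeCarrierAlgWOfDivInt.dvd_coeff_of_C_dvd _ _ hdvd n
    rw [PowerSeries.X_dvd_iff] at h1 ⊢
    rw [hFdef, hΦ₂, PowerSeries.coeff_map, hΦ₁, ← PowerSeries.coeff_zero_eq_constantCoeff_apply,
      PowerSeries.coeff_map, PowerSeries.coeff_zero_eq_constantCoeff_apply] at h1
    exact toUnr_injective (by rw [h1, map_zero])
  have hF0 : F ≠ 0 := fun h => hXF (h ▸ dvd_zero _)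
  refine ⟨F, PowerSeries (PowerSeries (unrIntegers p)) ⧸ Ideal.span {F}, inferInstance, inferInstance,
    inferInstance, inferInstance, inferInstance, ?_, hXF, ?_, Fx, hFx, fun k hk => ?_⟩
  · -- `char 𝒩 = (F)` for the cyclic witness
    exact Literature.NumberTheory.EllipticCurves.Module.charIdeal_quotient_span_singleton hF0
  · -- (alg∞): `F(0,T)` read in `𝓞_{ℂ_p}⟦T⟧` is `F₀(0,T)` read there
    obtain ⟨j, hj⟩ := halg₀
    refine ⟨j, ?_⟩
    have hread : PowerSeries.map (R1.unrToCpInt p)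
        (PowerSeries.map (PowerSeries.constantCoeff (R := unrIntegers p)) F) =
        PowerSeries.map (R1.toCpInt p) (PowerSeries.map (PowerSeries.constantCoeff (R := ℤ_[p])) F₀) := by
      rw [hFdef, hΦ₂, hΦ₁, TelescopeCarrierAlgWOfDivInt.map_constantCoeff_map_map, R1.map_unrToCpInt_map_toUnr]
    rw [hread]
    exact hj
  · obtain ⟨Φ₀, hΦ0, ⟨U, hU⟩, hctrl⟩ := hmem₀ k hk
    have ha : toUnr p (x k) ∈ IsLocalRing.maximalIdeal (unrIntegers p) := hpt _ (hxk k)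
    set π : PowerSeries (PowerSeries (unrIntegers p)) :=
      PowerSeries.C (PowerSeries.X - PowerSeries.C (toUnr p (x k))) with hπ
    -- the evaluation retraction `φ : R₀⟦X⟧⟦T⟧ → R₀⟦T⟧`, `X ↦ x_k`, kernel `(π)` (`TelescopeCarrierAlgOfWitness` §E, p729576)
    let φ : PowerSeries (PowerSeries (unrIntegers p)) →+* PowerSeries (unrIntegers p) :=
      PowerSeries.map (AccumHelpers.evAt (toUnr p (x k)) ha).toRingHom
    have hφC : ∀ g : PowerSeries (unrIntegers p),
        φ (algebraMap (PowerSeries (unrIntegers p)) (PowerSeries (PowerSeries (unrIntegers p))) g) = g :=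
      fun g => TelescopeCarrierAlgOfWitness.evAtMap_map_C _ ha g
    have hφC' : ∀ g : PowerSeries (unrIntegers p),
        φ (PowerSeries.map (PowerSeries.C (R := unrIntegers p)) g) = g :=
      fun g => TelescopeCarrierAlgOfWitness.evAtMap_map_C _ ha g
    have hφπ : φ π = 0 := TelescopeCarrierAlgOfWitness.evAtMap_pi _ ha
    have hφker : ∀ b : PowerSeries (PowerSeries (unrIntegers p)), φ b = 0 → π ∣ b :=
      fun b hb => TelescopeCarrierAlgOfWitness.C_dvd_of_evAtMap_eq_zero _ ha b hb
    -- the remainder identity transported: `Φ₀` (read in `R₀⟦T⟧`) `≡ F (mod π)`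
    have hid : PowerSeries.map (PowerSeries.C (R := unrIntegers p)) (Φ₁ Φ₀) = F + π * Φ₂ U := by
      have h1 := congrArg Φ₂ hU
      rw [map_add, map_mul, hΦ₂, TelescopeCarrierAlgWOfDivInt.map_map_map_C, PowerSeries.map_C, map_sub, PowerSeries.map_X, ← hΦ₂] at h1
      rw [h1, hFdef, hπ, hΦ₁, PowerSeries.map_C]
    have hφF : φ F = Φ₁ Φ₀ := by
      have h1 := congrArg φ hid
      rw [map_add, map_mul, hφπ, zero_mul, add_zero, hφC'] at h1
      exact h1.symm
    have hΦ10 : Φ₁ Φ₀ ≠ 0 := fun h => hΦ0 (hΦ₁inj (by rw [h, map_zero]))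
    refine ⟨⟨F, ?_, ?_⟩, ?_⟩
    · -- regularity: `π ∤ F` since `F(x_k,T) = Φ₀ ≠ 0`
      rintro ⟨V, hV⟩
      apply hΦ10
      rw [← hφF, hV, map_mul, hφπ, zero_mul]
    · -- `F` kills `𝒩 = R₀⟦X⟧⟦T⟧ ⧸ (F)`
      intro m
      obtain ⟨G, rfl⟩ := Ideal.Quotient.mk_surjective m
      change Ideal.Quotient.mk (Ideal.span {F}) (F * G) = 0
      exact Ideal.Quotient.eq_zero_iff_mem.mpr (Ideal.mul_mem_right _ _ (Ideal.subset_span rfl))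
    · -- control read in `𝓞_{ℂ_p}⟦T⟧`: `char(𝒩/π𝒩)·𝓞⟦T⟧ = (Φ₀)·𝓞⟦T⟧ ⊇ p^j·Ch(X(g_k))·𝓞⟦T⟧`
      intro b hb _ _
      obtain ⟨j, hj⟩ := hctrl b hb
      refine ⟨j, hj.trans (le_of_eq ?_)⟩
      obtain ⟨e⟩ := RetractionSpecialization.nonempty_quotSMulTop_quotient_linearEquiv'
        (A := PowerSeries (unrIntegers p)) hφC hφπ hφker (Ideal.span {F})
      rw [Literature.NumberTheory.EllipticCurves.Module.charIdeal_eq_of_linearEquiv e, Ideal.map_span,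
        Set.image_singleton, hφF,
        Literature.NumberTheory.EllipticCurves.Module.charIdeal_quotient_span_singleton hΦ10, Ideal.map_span,
        Set.image_singleton, hΦ₁, R1.map_unrToCpInt_map_toUnr]

end Summit.BirchSwinnertonDyer.BirchSwinnertonDyer.Theorems.TelescopeCarrierAlgWOfDivIntFP

end
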